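import Mathlib.Algebra.Module.Submodule.Ker
import Mathlib.Algebra.Module.Submodule.Range
import Mathlib.Data.Finset.Insert
import HarnessLib

/-!
# Howard 2004, Lemma 1.6.4 («`κ_n^{(k)} ∈ Stub^{(k)}(n) ⊗ G_n`») — the induction skeleton at one level

Topic `NumberTheory/GaloisCohomology/Howard2004` (the residual Galois input «Lemma 1.6.4 at `n = 1`» of
the print leaf G87 `Howard2004.thm161_dvrKolyvaginBound` = Thm. 1.6.1; cell `pub/bsd-print-x9`, seat
`bsd-line-x10b-p1-w2` g15).  THEOREMS ONLY: no definition, no named fact, no instance, no notation, no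
`sorry`; Mathlib-only imports.

Printed source.  B. Howard, *The Heegner point Kolyvagin system*, Compositio Math. **140** (2004)
= arXiv:1202.6340, Lemma 1.6.4 (arXiv Lemma 2.6.4, p. 11 L82 – p. 12 L27): «If `n ∈ 𝓝^{(2k-1)}`
then `κ_n^{(k)} ∈ Stub^{(k)}(n) ⊗ G_n`.  *Proof.* We argue by induction on both `k` and `ρ^{(k)}(n)`
… fix a generator for the cyclic group `G_ℓ` for every `ℓ` so that we may identify
`H¹_{F(n)}(K, T^{(k)}) ⊗ G_n ≅ H¹_{F(n)}(K, T^{(k)})`.  First suppose `Stub^{(k)}(n) ≠ 0` … [the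
liftability case] … proving this special case.  Now keep `k` fixed as above and suppose that
`n ∈ 𝓛^{(2k-1)}` gives a counterexample with `ρ(n)` minimal.  The above case shows that
`Stub^{(k)}(n) = 0`.  By Lemma (H.5 application), `ρ(n) = 0` or `1` implies that
`Stub^{(k)}(n) = H¹_{F(n)}(K, T^{(k)})`, and so we must have `ρ(n) > 1`.
Case i: `ρ(n)⁺` and `ρ(n)⁻` are both nonzero. … If `κ^{(k)}(n) ≠ 0` then it has some nonzero
multiple `d ∈ H¹_{F(n)}(K,T^{(k)})[𝔪]` … By Lemma (Cheb) we may choose a prime `ℓ ∈ 𝓛^{(2k-1)}` at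
which both `d⁺` and some element of `H¹_{F(n)}(K,T̄)⁻` have nontrivial localization.  By Lemma
(parity), `ρ(nℓ) = ρ(n) - 2`, and so by induction `κ^{(k)}(nℓ) ∈ Stub^{(k)}(nℓ)`.  By Proposition
(induction), `loc_ℓ(κ^{(k)}(nℓ)) = 0`, but then the Kolyvagin system relations imply that
`loc_ℓ(κ_n^{(k)}) = 0`, contradicting the choice of `ℓ`.
Case ii: one of `ρ(n)^±` is equal to zero. … choose a nonzero multiple … `d ∈ H¹_{F(n)}(K,T^{(k)})[𝔪]⁺`,
and a prime `ℓ ∈ 𝓛^{(2k-1)}` for which `loc_ℓ(d) ≠ 0`.  By Lemma (parity), `ρ(nℓ)^±` are both nonzero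
and `ρ(nℓ) = ρ(n)`.  Thus, by Case i, `κ^{(k)}_{nℓ} ∈ Stub^{(k)}(nℓ)`.  By Proposition (induction),
`loc_ℓ(Stub^{(k)}(nℓ)) = 0`, but the Kolyvagin system relations guarantee that
`loc_ℓ(κ^{(k)}_{nℓ}) ≠ 0`.  This is a contradiction.»

What is here: exactly this induction, MODULE-LEVEL (like the cell's algebraic cores
`IsotropicLineParity` (Lemma 1.5.3), `SymplecticTorsionModulesDVR` / (LAGR) (Lemma 1.5.7–Prop 1.5.9),
`PowSmulImageLiftability` (the liftability case)), with the five printed inputs as HYPOTHESES in the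
shapes those cores deliver.  DATA at the fixed level `k`: a set `P` of primes (`𝓛^{(2k-1)}`, as used
at this level), for every finite set `n` of primes an `R`-module `H n` (`H¹_{F(n)}(K, T^{(k)})`, the
`⊗ G_n` identified away by the printed choice of generators), its Kolyvagin class `κ n`, its stub
`Stub n` (`= 𝔪^{λ^{(k)}(n)} H¹_{F(n)}(K,T^{(k)})`), the two eigen-dimensions `ρp n`, `ρm n`
(`ρ(n)^±`), and the localisation maps `loc n ℓ : H n →ₗ[R] L n ℓ` (`loc_λ` on `H¹_{F(n)}(K,T^{(k)})`).
HYPOTHESES (each only for `↑n ⊆ P`, `ℓ ∈ P`, `ℓ ∉ n`):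
* `hKS` — «the Kolyvagin system relations»: `loc_ℓ κ_n = 0 ↔ loc_ℓ κ_{nℓ} = 0` (display (ks
  relations) with `φ^{fs}_ℓ` an isomorphism on the finite classes);
* `h159` — Proposition 1.5.9: `loc_ℓ(Stub(n)) = 0 ⟹ loc_ℓ(Stub(nℓ)) = 0`;
* `hsmall` — «`ρ(n) = 0` or `1` implies `Stub(n) = H¹_{F(n)}`» (Lemma 1.3.3 with Prop. 1.5.5);
* `hfirst` — «First suppose `Stub^{(k)}(n) ≠ 0` …»: the liftability case (the induction on `k`),
  an input here;
* `htors` — every class is killed by a power of `π` (`H¹_{F(n)}(K,T^{(k)})` is an `R/𝔪^k`-module);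
* `hchebI` — Case i's prime: for `ρ(n)^±` both `> 0` and `0 ≠ d ∈ H(n)[𝔪]`, a prime `ℓ ∈ P ∖ n` with
  `loc_ℓ d ≠ 0`, `ρ(nℓ)⁺ = ρ(n)⁺ - 1`, `ρ(nℓ)⁻ = ρ(n)⁻ - 1` (Lemma 1.6.2 for the three classes
  `d, d^±, c^∓` — `TauEigencocycleFrobeniusProofs` §7 — with the local criterion and Lemma 1.5.3(a)
  twice);
* `hchebII` — Case ii's prime: for `ρ(n)^∓ = 0`, `ρ(n)^± ≥ 2` and `0 ≠ d ∈ H(n)[𝔪]`, a prime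
  `ℓ ∈ P ∖ n` with `loc_ℓ d ≠ 0`, `ρ(nℓ)^±` both `> 0`, `ρ(nℓ) = ρ(n)` (Lemma 1.6.2 one class, Lemma
  1.5.3 (a) and (b)).
CONCLUSION `mem_stub_of_stubLemmaInduction : ↑n ⊆ P → κ n ∈ Stub n` — at `n = ∅` this is
«`κ_1^{(k)} ∈ 𝔪^{λ^{(k)}(1)} H¹_F(K, T^{(k)})`», the binder `h164` of the cell's
`DVRSetting.conclusion_of_package` at level `k`, ONCE INSTANTIATED.

* §1 `exists_smul_pow_ne_zero_and_smul_eq_zero` — «it has some nonzero multiple `d ∈ H[𝔪]`»;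
  `loc_ne_zero_of_loc_smul_pow_ne_zero`.
* §2 `mem_stub_caseI` (Case i at a fixed value of `ρ`, from the claim below that value),
  `mem_stub_of_sum_eq` (the claim at a fixed value of `ρ`), **`mem_stub_of_stubLemmaInduction`**.
* §3 the induction on the level: `mem_stub_of_ne_bot_of_lower_levels` (the liftability case at
  level `k` from the claim at the lower levels, hypotheses `hlam`/`hred`/`hlift` = package algebra,
  compatibility of the classes, Lemma 1.6.3 + liftability) and
  **`mem_stub_of_stubLemmaInduction_levels`** (all `k`, all `n ∈ 𝓝(𝓛^{(2k-1)})`).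

HONEST FRAMING.  Pure logic of the printed induction at ONE level `k`; the instantiation to the
cell's `DVRSetting` / `LevelData` (the `⊗ G_n` identification, Lemma 1.3.3 at level `n`, the level-`n`
structure `H¹_{F(n)} ≅ R^ε ⊕ M ⊕ M`, the discharge of the seven hypotheses from the landed cores) is
NOT here; Lemma 1.6.4, Thm. 1.6.1 and `thm161_dvrKolyvaginBound` are NOT proved; no summit statement
is proved; the Birch–Swinnerton-Dyer conjecture is not proved by any of this.

References: [Howard2004HeegnerKolyvagin] Lemma 1.6.4 (arXiv 2.6.4, p. 11 L82 – p. 12 L27), Lemma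
1.5.3, Prop. 1.5.9, Lemma 1.6.2, Def. 1.2.3; [MazurRubinMemoirs2004] §4.5 (the same induction for
`R = ℤ_p`, Thm. 4.5.1 / Prop. 4.5.8).
-/

set_option autoImplicit false

namespace Literature.NumberTheory.GaloisCohomology.Howard2004

variable {R : Type*} [CommRing R] {ι : Type*} [DecidableEq ι]
  {H : Finset ι → Type*} [∀ n, AddCommGroup (H n)] [∀ n, Module R (H n)]
  {L : Finset ι → ι → Type*} [∀ n ℓ, AddCommGroup (L n ℓ)] [∀ n ℓ, Module R (L n ℓ)]

/-! ## §1 «If `κ ≠ 0` then it has some nonzero multiple `d ∈ H[𝔪]`» -/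

/-- In a `π`-primary module a non-zero element has a non-zero multiple `d = π^j x` killed by `π`.
[cite: Howard2004HeegnerKolyvagin, Lemma 1.6.4 proof, Case i (arXiv p. 12 L2–3: «If `κ^{(k)}(n) ≠ 0` then it has some nonzero multiple `d ∈ H¹_{F(n)}(K,T^{(k)})[𝔪]`»)] -/
theorem exists_smul_pow_ne_zero_and_smul_eq_zero {M : Type*} [AddCommGroup M] [Module R M]
    (ϖ : R) {x : M} (hx : x ≠ 0) (htors : ∃ j : ℕ, ϖ ^ j • x = 0) :
    ∃ j : ℕ, ϖ ^ j • x ≠ 0 ∧ ϖ • (ϖ ^ j • x) = 0 := by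
  classical
  have h0 : ¬ (ϖ ^ 0 • x = 0) := by rwa [pow_zero, one_smul]
  let m := Nat.find htors
  have hm : ϖ ^ m • x = 0 := Nat.find_spec htors
  have hmpos : 0 < m := by
    rcases Nat.eq_zero_or_pos m with h | h
    · exact absurd (h ▸ hm) h0
    · exact h
  refine ⟨m - 1, Nat.find_min htors (Nat.sub_lt hmpos Nat.one_pos), ?_⟩
  rw [smul_smul, ← pow_succ', Nat.sub_add_cancel hmpos]
  exact hm

/-- `loc (π^j x) ≠ 0 ⟹ loc x ≠ 0`. [cite: Howard2004HeegnerKolyvagin, Lemma 1.6.4 proof (arXiv p. 12 L8–9, L19–21)] -/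
theorem loc_ne_zero_of_loc_smul_pow_ne_zero {M N : Type*} [AddCommGroup M] [Module R M]
    [AddCommGroup N] [Module R N] (f : M →ₗ[R] N) (ϖ : R) (j : ℕ) {x : M}
    (h : f (ϖ ^ j • x) ≠ 0) : f x ≠ 0 := by
  intro hx
  apply h
  rw [map_smul, hx, smul_zero]

/-! ## §2 The induction on `ρ(n)` -/

section Induction

variable (P : Set ι) (ϖ : R) (κ : ∀ n, H n) (Stub : ∀ n, Submodule R (H n))
  (ρp ρm : Finset ι → ℕ) (loc : ∀ n ℓ, H n →ₗ[R] L n ℓ)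

/-- **Case i of Lemma 1.6.4 at a fixed value `s` of `ρ(n)`**, from the claim for all `n'` with
`ρ(n') < s`: if `ρ(n)⁺ > 0` and `ρ(n)⁻ > 0` then `κ_n ∈ Stub(n)`.  «If `κ^{(k)}(n) ≠ 0` then it
has some nonzero multiple `d ∈ H[𝔪]` … choose a prime `ℓ` at which both `d⁺` and some element of
`H¹_{F(n)}(K,T̄)⁻` have nontrivial localization.  By Lemma (parity), `ρ(nℓ) = ρ(n) - 2`, and so by
induction `κ^{(k)}(nℓ) ∈ Stub^{(k)}(nℓ)`.  By Proposition (induction), `loc_ℓ(κ^{(k)}(nℓ)) = 0`,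
but then the Kolyvagin system relations imply that `loc_ℓ(κ_n^{(k)}) = 0`, contradicting the choice
of `ℓ`.» [cite: Howard2004HeegnerKolyvagin, Lemma 1.6.4 proof, Case i (arXiv p. 12 L1–12)] -/
theorem mem_stub_caseI
    (hKS : ∀ n (ℓ : ι), ↑n ⊆ P → ℓ ∈ P → ℓ ∉ n →
      (loc n ℓ (κ n) = 0 ↔ loc (insert ℓ n) ℓ (κ (insert ℓ n)) = 0))
    (h159 : ∀ n (ℓ : ι), ↑n ⊆ P → ℓ ∈ P → ℓ ∉ n →
      Stub n ≤ LinearMap.ker (loc n ℓ) → Stub (insert ℓ n) ≤ LinearMap.ker (loc (insert ℓ n) ℓ))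
    (hfirst : ∀ n, ↑n ⊆ P → Stub n ≠ ⊥ → κ n ∈ Stub n)
    (htors : ∀ n (x : H n), ∃ j : ℕ, ϖ ^ j • x = 0)
    (hchebI : ∀ n, ↑n ⊆ P → 0 < ρp n → 0 < ρm n → ∀ d : H n, d ≠ 0 → ϖ • d = 0 →
      ∃ ℓ ∈ P, ℓ ∉ n ∧ loc n ℓ d ≠ 0 ∧ ρp (insert ℓ n) + 1 = ρp n ∧ ρm (insert ℓ n) + 1 = ρm n)
    (s : ℕ) (ih : ∀ n, ↑n ⊆ P → ρp n + ρm n < s → κ n ∈ Stub n)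
    (n : Finset ι) (hn : ↑n ⊆ P) (hs : ρp n + ρm n = s) (hp : 0 < ρp n) (hm : 0 < ρm n) :
    κ n ∈ Stub n := by
  by_cases hstub : Stub n ≠ ⊥
  · exact hfirst n hn hstub
  push Not at hstub
  by_contra hκ
  have hκ0 : κ n ≠ 0 := by
    intro h
    exact hκ (h ▸ (Stub n).zero_mem)
  obtain ⟨j, hd, hdϖ⟩ := exists_smul_pow_ne_zero_and_smul_eq_zero ϖ hκ0 (htors n (κ n))
  obtain ⟨ℓ, hℓP, hℓn, hloc, hρp, hρm⟩ := hchebI n hn hp hm _ hd hdϖ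
  -- `ρ(nℓ) = ρ(n) - 2 < s`: the claim holds at `nℓ`
  have hsub : ↑(insert ℓ n) ⊆ P := by
    rw [Finset.coe_insert]
    exact Set.insert_subset hℓP hn
  have hmem : κ (insert ℓ n) ∈ Stub (insert ℓ n) := ih _ hsub (by omega)
  -- Prop. 1.5.9 (with `Stub(n) = 0`): `loc_ℓ κ_{nℓ} = 0`; (ks): `loc_ℓ κ_n = 0`
  have hker : Stub (insert ℓ n) ≤ LinearMap.ker (loc (insert ℓ n) ℓ) :=
    h159 n ℓ hn hℓP hℓn (by rw [hstub]; exact bot_le)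
  have h0 : loc n ℓ (κ n) = 0 := (hKS n ℓ hn hℓP hℓn).mpr (hker hmem)
  exact loc_ne_zero_of_loc_smul_pow_ne_zero (loc n ℓ) ϖ j hloc h0

/-- **The claim at a fixed value `s` of `ρ(n)`** from the claim below `s`: Case i as above; «`ρ(n) = 0`
or `1` implies `Stub(n) = H`»; and Case ii («one of `ρ(n)^±` is equal to zero … By Lemma (parity),
`ρ(nℓ)^±` are both nonzero and `ρ(nℓ) = ρ(n)`.  Thus, by Case i, `κ_{nℓ} ∈ Stub(nℓ)`.  By Proposition
(induction), `loc_ℓ(Stub(nℓ)) = 0`, but the Kolyvagin system relations guarantee that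
`loc_ℓ(κ_{nℓ}) ≠ 0`»). [cite: Howard2004HeegnerKolyvagin, Lemma 1.6.4 proof (arXiv p. 11 L95 – p. 12 L27)] -/
theorem mem_stub_of_sum_eq
    (hKS : ∀ n (ℓ : ι), ↑n ⊆ P → ℓ ∈ P → ℓ ∉ n →
      (loc n ℓ (κ n) = 0 ↔ loc (insert ℓ n) ℓ (κ (insert ℓ n)) = 0))
    (h159 : ∀ n (ℓ : ι), ↑n ⊆ P → ℓ ∈ P → ℓ ∉ n →
      Stub n ≤ LinearMap.ker (loc n ℓ) → Stub (insert ℓ n) ≤ LinearMap.ker (loc (insert ℓ n) ℓ))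
    (hsmall : ∀ n, ↑n ⊆ P → ρp n + ρm n ≤ 1 → Stub n = ⊤)
    (hfirst : ∀ n, ↑n ⊆ P → Stub n ≠ ⊥ → κ n ∈ Stub n)
    (htors : ∀ n (x : H n), ∃ j : ℕ, ϖ ^ j • x = 0)
    (hchebI : ∀ n, ↑n ⊆ P → 0 < ρp n → 0 < ρm n → ∀ d : H n, d ≠ 0 → ϖ • d = 0 →
      ∃ ℓ ∈ P, ℓ ∉ n ∧ loc n ℓ d ≠ 0 ∧ ρp (insert ℓ n) + 1 = ρp n ∧ ρm (insert ℓ n) + 1 = ρm n)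
    (hchebII : ∀ n, ↑n ⊆ P → (ρm n = 0 ∧ 2 ≤ ρp n) ∨ (ρp n = 0 ∧ 2 ≤ ρm n) →
      ∀ d : H n, d ≠ 0 → ϖ • d = 0 →
      ∃ ℓ ∈ P, ℓ ∉ n ∧ loc n ℓ d ≠ 0 ∧ 0 < ρp (insert ℓ n) ∧ 0 < ρm (insert ℓ n) ∧
        ρp (insert ℓ n) + ρm (insert ℓ n) = ρp n + ρm n)
    (s : ℕ) (ih : ∀ n, ↑n ⊆ P → ρp n + ρm n < s → κ n ∈ Stub n)
    (n : Finset ι) (hn : ↑n ⊆ P) (hs : ρp n + ρm n = s) : κ n ∈ Stub n := by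
  have caseI := mem_stub_caseI P ϖ κ Stub ρp ρm loc hKS h159 hfirst htors hchebI s ih
  by_cases hstub : Stub n ≠ ⊥
  · exact hfirst n hn hstub
  push Not at hstub
  by_cases hle : ρp n + ρm n ≤ 1
  · rw [hsmall n hn hle]
    exact Submodule.mem_top
  by_cases hpos : 0 < ρp n ∧ 0 < ρm n
  · exact caseI n hn hs hpos.1 hpos.2
  -- Case ii: one of `ρ(n)^±` vanishes, the other is `≥ 2`
  have hII : (ρm n = 0 ∧ 2 ≤ ρp n) ∨ (ρp n = 0 ∧ 2 ≤ ρm n) := by omega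
  by_contra hκ
  have hκ0 : κ n ≠ 0 := by
    intro h
    exact hκ (h ▸ (Stub n).zero_mem)
  obtain ⟨j, hd, hdϖ⟩ := exists_smul_pow_ne_zero_and_smul_eq_zero ϖ hκ0 (htors n (κ n))
  obtain ⟨ℓ, hℓP, hℓn, hloc, hp', hm', hsum⟩ := hchebII n hn hII _ hd hdϖ
  have hsub : ↑(insert ℓ n) ⊆ P := by
    rw [Finset.coe_insert]
    exact Set.insert_subset hℓP hn
  -- Case i at `nℓ` (same `ρ`, both signs positive)
  have hmem : κ (insert ℓ n) ∈ Stub (insert ℓ n) := caseI _ hsub (by omega) hp' hm'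
  have hker : Stub (insert ℓ n) ≤ LinearMap.ker (loc (insert ℓ n) ℓ) :=
    h159 n ℓ hn hℓP hℓn (by rw [hstub]; exact bot_le)
  have h0 : loc n ℓ (κ n) = 0 := (hKS n ℓ hn hℓP hℓn).mpr (hker hmem)
  exact loc_ne_zero_of_loc_smul_pow_ne_zero (loc n ℓ) ϖ j hloc h0

/-- **Howard's Lemma 1.6.4 at one level, from its printed inputs: `κ_n ∈ Stub(n)` for every
`n ∈ 𝓝(P)`** (induction on `ρ(n) = ρ(n)⁺ + ρ(n)⁻`).  At `n = ∅`: `κ_1^{(k)} ∈ 𝔪^{λ^{(k)}(1)}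
H¹_F(K, T^{(k)})`. [cite: Howard2004HeegnerKolyvagin, Lemma 1.6.4 (arXiv Lemma 2.6.4, p. 11 L82 – p. 12 L27)] -/
theorem mem_stub_of_stubLemmaInduction
    (hKS : ∀ n (ℓ : ι), ↑n ⊆ P → ℓ ∈ P → ℓ ∉ n →
      (loc n ℓ (κ n) = 0 ↔ loc (insert ℓ n) ℓ (κ (insert ℓ n)) = 0))
    (h159 : ∀ n (ℓ : ι), ↑n ⊆ P → ℓ ∈ P → ℓ ∉ n →
      Stub n ≤ LinearMap.ker (loc n ℓ) → Stub (insert ℓ n) ≤ LinearMap.ker (loc (insert ℓ n) ℓ))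
    (hsmall : ∀ n, ↑n ⊆ P → ρp n + ρm n ≤ 1 → Stub n = ⊤)
    (hfirst : ∀ n, ↑n ⊆ P → Stub n ≠ ⊥ → κ n ∈ Stub n)
    (htors : ∀ n (x : H n), ∃ j : ℕ, ϖ ^ j • x = 0)
    (hchebI : ∀ n, ↑n ⊆ P → 0 < ρp n → 0 < ρm n → ∀ d : H n, d ≠ 0 → ϖ • d = 0 →
      ∃ ℓ ∈ P, ℓ ∉ n ∧ loc n ℓ d ≠ 0 ∧ ρp (insert ℓ n) + 1 = ρp n ∧ ρm (insert ℓ n) + 1 = ρm n)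
    (hchebII : ∀ n, ↑n ⊆ P → (ρm n = 0 ∧ 2 ≤ ρp n) ∨ (ρp n = 0 ∧ 2 ≤ ρm n) →
      ∀ d : H n, d ≠ 0 → ϖ • d = 0 →
      ∃ ℓ ∈ P, ℓ ∉ n ∧ loc n ℓ d ≠ 0 ∧ 0 < ρp (insert ℓ n) ∧ 0 < ρm (insert ℓ n) ∧
        ρp (insert ℓ n) + ρm (insert ℓ n) = ρp n + ρm n)
    (n : Finset ι) (hn : ↑n ⊆ P) : κ n ∈ Stub n := by
  suffices h : ∀ s (n : Finset ι), ↑n ⊆ P → ρp n + ρm n = s → κ n ∈ Stub n from h _ n hn rfl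
  intro s
  induction s using Nat.strong_induction_on with
  | _ s ih =>
    intro n hn hs
    exact mem_stub_of_sum_eq P ϖ κ Stub ρp ρm loc hKS h159 hsmall hfirst htors hchebI hchebII s
      (fun n' hn' hlt => ih _ (hs ▸ hlt) n' hn' rfl) n hn hs

/-- **The `n = 1` instance** (the binder `h164` of the cell's Thm. 1.6.1 assembly, at one level):
`κ_1 ∈ Stub(1)`. [cite: Howard2004HeegnerKolyvagin, Lemma 1.6.4 at n = 1 and proof of Thm. 1.6.1 (arXiv p. 12 L29–35: «Taking `n = 1` in Lemma (lemma of the stub), we have `κ_1^{(k)} ∈ Stub^{(k)}`»)] -/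
theorem kappa_empty_mem_stub_of_stubLemmaInduction
    (hKS : ∀ n (ℓ : ι), ↑n ⊆ P → ℓ ∈ P → ℓ ∉ n →
      (loc n ℓ (κ n) = 0 ↔ loc (insert ℓ n) ℓ (κ (insert ℓ n)) = 0))
    (h159 : ∀ n (ℓ : ι), ↑n ⊆ P → ℓ ∈ P → ℓ ∉ n →
      Stub n ≤ LinearMap.ker (loc n ℓ) → Stub (insert ℓ n) ≤ LinearMap.ker (loc (insert ℓ n) ℓ))
    (hsmall : ∀ n, ↑n ⊆ P → ρp n + ρm n ≤ 1 → Stub n = ⊤)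
    (hfirst : ∀ n, ↑n ⊆ P → Stub n ≠ ⊥ → κ n ∈ Stub n)
    (htors : ∀ n (x : H n), ∃ j : ℕ, ϖ ^ j • x = 0)
    (hchebI : ∀ n, ↑n ⊆ P → 0 < ρp n → 0 < ρm n → ∀ d : H n, d ≠ 0 → ϖ • d = 0 →
      ∃ ℓ ∈ P, ℓ ∉ n ∧ loc n ℓ d ≠ 0 ∧ ρp (insert ℓ n) + 1 = ρp n ∧ ρm (insert ℓ n) + 1 = ρm n)
    (hchebII : ∀ n, ↑n ⊆ P → (ρm n = 0 ∧ 2 ≤ ρp n) ∨ (ρp n = 0 ∧ 2 ≤ ρm n) →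
      ∀ d : H n, d ≠ 0 → ϖ • d = 0 →
      ∃ ℓ ∈ P, ℓ ∉ n ∧ loc n ℓ d ≠ 0 ∧ 0 < ρp (insert ℓ n) ∧ 0 < ρm (insert ℓ n) ∧
        ρp (insert ℓ n) + ρm (insert ℓ n) = ρp n + ρm n) :
    κ ∅ ∈ Stub ∅ :=
  mem_stub_of_stubLemmaInduction P ϖ κ Stub ρp ρm loc hKS h159 hsmall hfirst htors hchebI hchebII
    ∅ (by simp)

end Induction

/-! ## §3 The induction on the level `k` («Let `k > 0` be the minimal integer for which the claim is false») -/

section Levels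

variable {H : ℕ → Finset ι → Type*} [∀ k n, AddCommGroup (H k n)] [∀ k n, Module R (H k n)]
  {L : ℕ → Finset ι → ι → Type*} [∀ k n ℓ, AddCommGroup (L k n ℓ)] [∀ k n ℓ, Module R (L k n ℓ)]
  (P : ℕ → Set ι) (ϖ : R) (κ : ∀ k n, H k n) (Stub : ∀ k n, Submodule R (H k n))
  (lam : ℕ → Finset ι → ℕ) (ρp ρm : ℕ → Finset ι → ℕ) (loc : ∀ k n ℓ, H k n →ₗ[R] L k n ℓ)
  (red : ∀ k i n, H k n →ₗ[R] H i n)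

omit [DecidableEq ι] in
/-- **The liftability case from the lower levels** («First suppose `Stub^{(k)}(n) ≠ 0`, so that in
particular we are in the case `ε = 1`, and `λ^{(k)}(n) < k`.  Let `i = λ^{(k)}(n)`.  By minimality of
`k`, `κ^{(i)}_n ∈ Stub^{(i)}(n)`.  By Lemma (H.5 application) … `λ^{(i)}(n) = λ^{(k)}(n) = i`.  This
implies that `Stub^{(i)}(n) = 0`, and so `κ^{(i)}_n = 0` … by Lemma (liftability), `κ_n^{(k)}` is
divisible by `π^i` in `H¹_{F(n)}(K,T^{(k)})`, proving this special case.»)  Levels are indexed by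
their exponent (`T^{(k)} = T/𝔪^k`, `P k = 𝓛^{(2k-1)}` decreasing in `k`); HYPOTHESES: `hlam` — for
`Stub^{(k)}(n) ≠ 0`, `i = λ^{(k)}(n) < k` and `Stub^{(i)}(n) = 0` (the package algebra with Lemma
1.3.3's `M^{(i)} ≅ M^{(k)}[𝔪^i]`); `hred` — `red(κ^{(k)}_n) = κ^{(i)}_n` (compatibility of the
Kolyvagin classes); `hlift` — for `Stub^{(k)}(n) ≠ 0`, `red_{k→i}(κ^{(k)}_n) = 0 ⟹ κ^{(k)}_n ∈
Stub^{(k)}(n)` (Lemma 1.3.3: `red_{k→i} x = 0 ⟺ π^{k-i}x = 0`, and Lemma 1.6.3 + liftability inside the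
free rank-one image of `H¹_{F(n)}(K,T^{(2k-1)})`).
[cite: Howard2004HeegnerKolyvagin, Lemma 1.6.4 proof, first case (arXiv p. 11 L85 – p. 12 L1)] -/
theorem mem_stub_of_ne_bot_of_lower_levels
    (hP : ∀ i k, i ≤ k → P k ⊆ P i)
    (hlam : ∀ k n, ↑n ⊆ P k → Stub k n ≠ ⊥ → lam k n < k ∧ Stub (lam k n) n = ⊥)
    (hred : ∀ k i n, i ≤ k → red k i n (κ k n) = κ i n)
    (hlift : ∀ k n, ↑n ⊆ P k → Stub k n ≠ ⊥ → red k (lam k n) n (κ k n) = 0 → κ k n ∈ Stub k n)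
    (k : ℕ) (ih : ∀ i, i < k → ∀ n, ↑n ⊆ P i → κ i n ∈ Stub i n)
    (n : Finset ι) (hn : ↑n ⊆ P k) (hst : Stub k n ≠ ⊥) : κ k n ∈ Stub k n := by
  obtain ⟨hi, hbot⟩ := hlam k n hn hst
  have hmem : κ (lam k n) n ∈ Stub (lam k n) n := ih _ hi n (fun x hx => hP _ _ hi.le (hn hx))
  rw [hbot, Submodule.mem_bot] at hmem
  refine hlift k n hn hst ?_
  rw [hred k (lam k n) n hi.le, hmem]

/-- **Howard's Lemma 1.6.4 from its printed inputs, all levels: `κ^{(k)}_n ∈ Stub^{(k)}(n)` for every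
`k` and every `n ∈ 𝓝(𝓛^{(2k-1)})`** — the double induction («on both `k` and `ρ^{(k)}(n)`»): at each
level the induction on `ρ(n)` of §2, whose liftability case is supplied by the lower levels
(`mem_stub_of_ne_bot_of_lower_levels`).  Hypotheses as in `mem_stub_of_stubLemmaInduction` at every
level (`hKS`, `h159`, `hsmall`, `htors`, `hchebI`, `hchebII`) plus `hP`, `hlam`, `hred`, `hlift`.
[cite: Howard2004HeegnerKolyvagin, Lemma 1.6.4 (arXiv Lemma 2.6.4, p. 11 L82 – p. 12 L27)] -/
theorem mem_stub_of_stubLemmaInduction_levels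
    (hP : ∀ i k, i ≤ k → P k ⊆ P i)
    (hlam : ∀ k n, ↑n ⊆ P k → Stub k n ≠ ⊥ → lam k n < k ∧ Stub (lam k n) n = ⊥)
    (hred : ∀ k i n, i ≤ k → red k i n (κ k n) = κ i n)
    (hlift : ∀ k n, ↑n ⊆ P k → Stub k n ≠ ⊥ → red k (lam k n) n (κ k n) = 0 → κ k n ∈ Stub k n)
    (hKS : ∀ k n (ℓ : ι), ↑n ⊆ P k → ℓ ∈ P k → ℓ ∉ n →
      (loc k n ℓ (κ k n) = 0 ↔ loc k (insert ℓ n) ℓ (κ k (insert ℓ n)) = 0))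
    (h159 : ∀ k n (ℓ : ι), ↑n ⊆ P k → ℓ ∈ P k → ℓ ∉ n →
      Stub k n ≤ LinearMap.ker (loc k n ℓ) →
        Stub k (insert ℓ n) ≤ LinearMap.ker (loc k (insert ℓ n) ℓ))
    (hsmall : ∀ k n, ↑n ⊆ P k → ρp k n + ρm k n ≤ 1 → Stub k n = ⊤)
    (htors : ∀ k n (x : H k n), ∃ j : ℕ, ϖ ^ j • x = 0)
    (hchebI : ∀ k n, ↑n ⊆ P k → 0 < ρp k n → 0 < ρm k n → ∀ d : H k n, d ≠ 0 → ϖ • d = 0 →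
      ∃ ℓ ∈ P k, ℓ ∉ n ∧ loc k n ℓ d ≠ 0 ∧ ρp k (insert ℓ n) + 1 = ρp k n ∧
        ρm k (insert ℓ n) + 1 = ρm k n)
    (hchebII : ∀ k n, ↑n ⊆ P k → (ρm k n = 0 ∧ 2 ≤ ρp k n) ∨ (ρp k n = 0 ∧ 2 ≤ ρm k n) →
      ∀ d : H k n, d ≠ 0 → ϖ • d = 0 →
      ∃ ℓ ∈ P k, ℓ ∉ n ∧ loc k n ℓ d ≠ 0 ∧ 0 < ρp k (insert ℓ n) ∧ 0 < ρm k (insert ℓ n) ∧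
        ρp k (insert ℓ n) + ρm k (insert ℓ n) = ρp k n + ρm k n)
    (k : ℕ) (n : Finset ι) (hn : ↑n ⊆ P k) : κ k n ∈ Stub k n := by
  induction k using Nat.strong_induction_on generalizing n with
  | _ k ih =>
    exact mem_stub_of_stubLemmaInduction (P k) ϖ (κ k) (Stub k) (ρp k) (ρm k) (loc k) (hKS k)
      (h159 k) (hsmall k)
      (mem_stub_of_ne_bot_of_lower_levels P κ Stub lam red hP hlam hred hlift k ih)
      (htors k) (hchebI k) (hchebII k) n hn

end Levels

end Literature.NumberTheory.GaloisCohomology.Howard2004
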